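import Literature.Analysis.FluidPDE.PassiveVectorGalerkinExistence
import HarnessLib

/-!
# The Fourier–Galerkin scheme for the passive solenoidal vector (`A = 0`) with a trigonometric-polynomial
  carrier, V: passage to the limit in the weak formulation; the weak solution

Analysis/FluidPDE proof-support file (theorems only; no named facts), sequel of `PassiveVectorGalerkinExistence`.
For the data `Torus.PVSetup κ b B β C Sec w₀` (trigonometric-polynomial carrier `b`, a frequency set `Sec` stable under
the carrier frequencies, an `L²` weakly divergence-free datum `w₀` supported in `Sec` with zero mean mode) and a
Galerkin limit `w` (`Torus.PVSetup.IsGalerkinLimit`), the Galerkin equations in weak form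
(`PVSetup.galerkin_weak_identity`, Robinson–Rodrigo–Sadowski 2016, Thm. 4.4 Step 4) pass to the limit `N → ∞`:

* the test field truncated inside the transport term is replaced by the test field at a cost
  `‖b‖_∞ · ∑ᵢ sup |∂ᵢΨ - P_N ∂ᵢΨ| = O(lattice tail)` uniformly on `[0,T] × T^d`
  (`Torus.exists_norm_sub_fourierTruncate_le_spaceTime`);
* the slices converge weakly in `L²` (`IsGalerkinLimit.tendsto_integral_inner`), the tested terms are bounded
  uniformly, and dominated convergence in time gives **the weak formulation of the limit**
  (`IsGalerkinLimit.weak_eq`);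
* with the bookkeeping of `PassiveVectorGalerkinExistence` the limit is a weak solution
  `Torus.IsWeakPassiveVectorOn 0 T κ b w₀ w` for every `T > 0` (`IsGalerkinLimit.isWeakPassiveVectorOn`), Fourier
  supported in `Sec ∖ {0}` and obeying the sector-Poincaré decay `∫‖w t‖² ≤ e^{-8π²κR²t}∫‖w₀‖²` for every `t ≥ 0`
  (`PVSetup.exists_weak_solution`).

## References

* J. C. Robinson, J. L. Rodrigo, W. Sadowski, *The three-dimensional Navier–Stokes equations*
  (CUP 2016), Thm. 4.4 Step 4, (4.5), Lemma 4.1. [`RobinsonRodrigoSadowski2016`]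
* K. Yoshida, Y. Kaneda, Phys. Rev. E 63 (2000) 016308, §II eq. (4)–(5). [`YoshidaKaneda2000`]
* R. J. DiPerna, P.-L. Lions, Invent. Math. 98 (1989) 511–547, §II.1 (12)–(14). [`DiPernaLions1989`]
-/

open MeasureTheory Set Filter Topology UnitAddTorus Metric Function
open scoped ENNReal NNReal InnerProductSpace

noncomputable section

namespace Literature.Analysis.FluidPDE

namespace Torus

open FunctionSpaces.Torus FunctionSpaces

variable {d : Type*} [Fintype d] [DecidableEq d]

/-! ## Continuity in time of the tested Galerkin terms -/

section Continuity

variable {b : ℝ → UnitAddTorus d → EuclideanSpace ℝ d} {B : Finset (d → ℤ)}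
  {β : ℝ → (d → ℤ) → EuclideanSpace ℂ d} {C κ : ℝ} {Sec : Set (d → ℤ)}
  {w₀ : UnitAddTorus d → EuclideanSpace ℝ d}

/-- The extended Galerkin coefficients are continuous on `[0, ∞)`. [cite: RobinsonRodrigoSadowski2016, Thm. 4.4 Step 1 (4.5)] -/
theorem PVSetup.continuousOn_galerkinCoeffAt (h : PVSetup κ b B β C Sec w₀) (N : ℕ) (k : d → ℤ) :
    ContinuousOn (fun t => h.galerkinCoeffAt N t k) (Ici 0) := by
  by_cases hk : k ∈ freqBall N
  · have e : (fun t => h.galerkinCoeffAt N t k) = fun t => h.galerkinCoeff N t ⟨k, hk⟩ := by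
      funext t; rw [PVSetup.galerkinCoeffAt, coeffExt_of_mem _ hk]
    rw [e]
    exact (continuous_apply _).comp_continuousOn (h.galerkinCoeff_spec N).2.2.1
  · have e : (fun t => h.galerkinCoeffAt N t k) = fun _ => 0 := by
      funext t; rw [PVSetup.galerkinCoeffAt, coeffExt_of_not_mem _ hk]
    rw [e]
    exact continuousOn_const

/-- The space–time lift of the Galerkin approximation is continuous on `[0, ∞) × ℝ^d`. [cite: RobinsonRodrigoSadowski2016, Thm. 4.4 Step 1 (4.3)] -/
theorem PVSetup.continuousOn_stLift_galerkinApprox (h : PVSetup κ b B β C Sec w₀) (N : ℕ) :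
    ContinuousOn (stLift (h.galerkinApprox N)) (Ici 0 ×ˢ (univ : Set (EuclideanSpace ℝ d))) := by
  have e : stLift (h.galerkinApprox N) = fun q : ℝ × EuclideanSpace ℝ d =>
      ∑ k ∈ freqBall N, EuclideanSpace.realPart (mFourier k (proj q.2) • h.galerkinCoeffAt N q.1 k) := by
    funext q
    obtain ⟨t, y⟩ := q
    rw [stLift_apply, PVSetup.galerkinApprox, realTrigPoly_apply_eq_sum]
  rw [e]
  refine continuousOn_finsetSum _ fun k _ => EuclideanSpace.realPart.continuous.comp_continuousOn ?_
  exact (((mFourier k).continuous.comp (continuous_proj.comp continuous_snd)).continuousOn).smul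
    ((h.continuousOn_galerkinCoeffAt N k).comp continuous_fst.continuousOn fun q hq => (mem_prod.1 hq).1)

omit [DecidableEq d] in
/-- The Fourier coefficients of the partial derivatives of a test field are continuous in time. [folklore] -/
private theorem continuous_mFourierCoeff_partialDeriv_test [DecidableEq d] {T : ℝ}
    {Ψ : ℝ → UnitAddTorus d → EuclideanSpace ℝ d} (hΨ : IsSpaceTimeTest T Ψ) (i : d) (k : d → ℤ) :
    Continuous fun t => mFourierCoeff (EuclideanSpace.complexify ∘ FunctionSpaces.Torus.partialDeriv i (Ψ t)) k := by
  rw [← continuousOn_univ]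
  have h : ContinuousOn (stLift fun t => FunctionSpaces.Torus.partialDeriv i (Ψ t)) (univ ×ˢ univ) :=
    (hΨ.isSmoothSpaceTimeOn_partialDeriv i).continuous_stLift_of_univ.continuousOn
  exact continuousOn_mFourierCoeff_of_continuousOn_stLift h k

/-- **The tested field `∂ₜΨ + (b·∇)(P_N Ψ) + κΔΨ` has a continuous space–time lift** (trigonometric-polynomial
carrier, `∂ᵢ P_N Ψ = P_N ∂ᵢ Ψ` with coefficients continuous in time). [cite: RobinsonRodrigoSadowski2016, Thm. 4.4 Step 4 (4.5)] -/
theorem TrigPolyCarrier.continuous_stLift_tested (hc : TrigPolyCarrier b B β C) {T : ℝ}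
    {Ψ : ℝ → UnitAddTorus d → EuclideanSpace ℝ d} (hΨ : IsSpaceTimeTest T Ψ) (κ : ℝ) (N : ℕ) :
    Continuous (stLift fun t x => FunctionSpaces.Torus.timeDeriv Ψ t x + FunctionSpaces.Torus.convect (b t) (fourierTruncate N (Ψ t)) x +
      κ • FunctionSpaces.Torus.laplacian (Ψ t) x) := by
  have hD : ∀ i, Continuous (stLift fun t x => fourierTruncate N (FunctionSpaces.Torus.partialDeriv i (Ψ t)) x) := fun i =>
    continuous_stLift_fourierTruncate (continuous_mFourierCoeff_partialDeriv_test hΨ i) N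
  have e : (stLift fun t x => FunctionSpaces.Torus.timeDeriv Ψ t x + FunctionSpaces.Torus.convect (b t) (fourierTruncate N (Ψ t)) x + κ • FunctionSpaces.Torus.laplacian (Ψ t) x) =
      fun q => stLift (FunctionSpaces.Torus.timeDeriv Ψ) q +
        ∑ i, (stLift b q) i • stLift (fun t x => fourierTruncate N (FunctionSpaces.Torus.partialDeriv i (Ψ t)) x) q +
        κ • stLift (fun t => FunctionSpaces.Torus.laplacian (Ψ t)) q := by
    funext q
    obtain ⟨t, y⟩ := q
    simp only [stLift_apply, FunctionSpaces.Torus.convect]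
    rw [fderiv_apply_eq_sum_partialDeriv ((isSmooth_fourierTruncate N (Ψ t)).isContDiff (by simp))]
    congr 2
    refine Finset.sum_congr rfl fun i _ => ?_
    rw [partialDeriv_fourierTruncate (hΨ.isSmooth_slice t)]
  rw [e]
  exact (hΨ.timeDeriv.1.continuous.add (continuous_finsetSum _ fun i _ =>
    ((EuclideanSpace.proj (𝕜 := ℝ) i).continuous.comp hc.continuous_stLift).smul (hD i))).add
    (hΨ.isSmoothSpaceTimeOn_laplacian.continuous_stLift_of_univ.const_smul κ)

/-- **The tested Galerkin term is continuous in time** on `[0, ∞)`: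
`t ↦ ∫⟪u_N(t), ∂ₜΨ(t) + (b(t)·∇)(P_N Ψ(t)) + κΔΨ(t)⟫`. [cite: RobinsonRodrigoSadowski2016, Thm. 4.4 Step 4 (4.5)] -/
theorem PVSetup.continuousOn_galerkinTested (h : PVSetup κ b B β C Sec w₀) {T : ℝ}
    {Ψ : ℝ → UnitAddTorus d → EuclideanSpace ℝ d} (hΨ : IsSpaceTimeTest T Ψ) (N : ℕ) :
    ContinuousOn (fun t => ∫ x, ⟪h.galerkinApprox N t x, FunctionSpaces.Torus.timeDeriv Ψ t x +
        FunctionSpaces.Torus.convect (b t) (fourierTruncate N (Ψ t)) x + κ • FunctionSpaces.Torus.laplacian (Ψ t) x⟫_ℝ) (Ici 0) := by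
  refine continuousOn_integral_of_continuousOn_stLift ?_
  have e : (stLift fun t x => ⟪h.galerkinApprox N t x, FunctionSpaces.Torus.timeDeriv Ψ t x +
      FunctionSpaces.Torus.convect (b t) (fourierTruncate N (Ψ t)) x + κ • FunctionSpaces.Torus.laplacian (Ψ t) x⟫_ℝ) =
      fun q => ⟪stLift (h.galerkinApprox N) q, stLift (fun t x => FunctionSpaces.Torus.timeDeriv Ψ t x +
        FunctionSpaces.Torus.convect (b t) (fourierTruncate N (Ψ t)) x + κ • FunctionSpaces.Torus.laplacian (Ψ t) x) q⟫_ℝ := by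
    funext q
    obtain ⟨t, y⟩ := q
    rfl
  rw [e]
  exact (h.continuousOn_stLift_galerkinApprox N).inner (h.carrier.continuous_stLift_tested hΨ κ N).continuousOn

end Continuity

/-! ## The truncation error inside the transport term -/

section Truncation

omit [DecidableEq d] in
/-- **Uniform truncation error for the gradient of a test field**: there is `K ≥ 0` with
`∑ᵢ ‖∂ᵢΨ(t)(x) - P_N(∂ᵢΨ(t))(x)‖ ≤ K · ∑_{k ∉ ball N} ((1 + |k|²)^{#d})⁻¹` for all `N`, `t ∈ [0, T₁]`, `x`. [cite: RobinsonRodrigoSadowski2016, Thm. 4.4 Step 4] -/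
theorem exists_sum_norm_partialDeriv_sub_fourierTruncate_le [DecidableEq d] {T : ℝ}
    {Ψ : ℝ → UnitAddTorus d → EuclideanSpace ℝ d} (hΨ : IsSpaceTimeTest T Ψ) (T₁ : ℝ) :
    ∃ K : ℝ, 0 ≤ K ∧ ∀ N : ℕ, ∀ t ∈ Icc 0 T₁, ∀ x,
      ∑ i, ‖FunctionSpaces.Torus.partialDeriv i (Ψ t) x - fourierTruncate N (FunctionSpaces.Torus.partialDeriv i (Ψ t)) x‖ ≤
        K * ∑' k : {k // k ∉ freqBall (d := d) N}, ((1 + freqNormSq (k : d → ℤ)) ^ Fintype.card d)⁻¹ := by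
  choose K hK0 hK using fun i =>
    exists_norm_sub_fourierTruncate_le_spaceTime (hΨ.isSmoothSpaceTimeOn_partialDeriv i) T₁
  refine ⟨∑ i, K i, Finset.sum_nonneg fun i _ => hK0 i, fun N t ht x => ?_⟩
  rw [Finset.sum_mul]
  exact Finset.sum_le_sum fun i _ => hK i N t ht x

/-- **Pointwise truncation error of the transport term**:
`‖(b·∇)(P_N a)(x) - (b·∇)a(x)‖ ≤ ‖b(x)‖ · ∑ᵢ ‖∂ᵢa(x) - P_N(∂ᵢa)(x)‖` for smooth `a`
(`∂ᵢ P_N a = P_N ∂ᵢ a`). [cite: RobinsonRodrigoSadowski2016, Lemma 2.9] -/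
theorem norm_convect_fourierTruncate_sub_le {bb : UnitAddTorus d → EuclideanSpace ℝ d}
    {a : UnitAddTorus d → EuclideanSpace ℝ d} (ha : IsSmooth a) (N : ℕ) (x : UnitAddTorus d) :
    ‖FunctionSpaces.Torus.convect bb (fourierTruncate N a) x - FunctionSpaces.Torus.convect bb a x‖ ≤
      ‖bb x‖ * ∑ i, ‖FunctionSpaces.Torus.partialDeriv i a x - fourierTruncate N (FunctionSpaces.Torus.partialDeriv i a) x‖ := by
  have hP : IsSmooth (fourierTruncate N a) := isSmooth_fourierTruncate N a
  have e : FunctionSpaces.Torus.convect bb (fourierTruncate N a) x - FunctionSpaces.Torus.convect bb a x =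
      -(FunctionSpaces.Torus.convect bb (fun y => a y - fourierTruncate N a y) x) := by
    rw [convect_sub_apply ha hP]
    simp only [neg_sub]
  rw [e, norm_neg]
  refine (norm_convect_le bb ((ha.sub hP).isContDiff (by simp)) x).trans
    (mul_le_mul_of_nonneg_left (le_of_eq ?_) (norm_nonneg _))
  refine Finset.sum_congr rfl fun i _ => ?_
  rw [show a - fourierTruncate N a = fun y => a y - fourierTruncate N a y from rfl,
    partialDeriv_sub_apply ha hP, partialDeriv_fourierTruncate ha]

end Truncation

/-! ## The weak formulation of the Galerkin limit -/

section WeakForm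

variable {b : ℝ → UnitAddTorus d → EuclideanSpace ℝ d} {B : Finset (d → ℤ)}
  {β : ℝ → (d → ℤ) → EuclideanSpace ℂ d} {C κ : ℝ} {Sec : Set (d → ℤ)}
  {w₀ : UnitAddTorus d → EuclideanSpace ℝ d}
  {h : PVSetup κ b B β C Sec w₀} {φ : ℕ → ℕ} {c : ℝ → (d → ℤ) → EuclideanSpace ℂ d}
  {w : ℝ → UnitAddTorus d → EuclideanSpace ℝ d}

/-- `∫‖u_N(t)‖² ≤ ∫‖w₀‖²` for `t ≥ 0` (Parseval for the approximation and the coefficient-energy bound). [cite: RobinsonRodrigoSadowski2016, Thm. 4.4 Step 2 (4.8)] -/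
theorem PVSetup.integral_norm_sq_galerkinApprox_le (h : PVSetup κ b B β C Sec w₀) (N : ℕ) {t : ℝ} (ht : 0 ≤ t) :
    ∫ x, ‖h.galerkinApprox N t x‖ ^ 2 ≤ ∫ x, ‖w₀ x‖ ^ 2 := by
  rw [PVSetup.galerkinApprox, integral_norm_sq_realTrigPoly neg_mem_freqBall_of_mem (h.isConjSymm_galerkinCoeffAt N t)]
  have := h.sum_norm_sq_galerkinCoeffAt_le N (R := 0) (fun k _ _ => by rw [sq, zero_mul]; exact freqNormSq_nonneg k) ht
    (freqBall N)
  simpa using this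

omit [Fintype d] [DecidableEq d] in
/-- `|⟪u, v⟫| ≤ L (‖u‖² + 1)/2` when `‖v‖ ≤ L`, `L ≥ 0`. [folklore] -/
private theorem abs_inner_le_half_of_norm_le {E : Type*} [NormedAddCommGroup E] [InnerProductSpace ℝ E] (u v : E) {L : ℝ}
    (hL : 0 ≤ L) (hv : ‖v‖ ≤ L) : |⟪u, v⟫_ℝ| ≤ L / 2 * ‖u‖ ^ 2 + L / 2 := by
  refine (abs_real_inner_le_norm u v).trans ?_
  have h1 : ‖u‖ * ‖v‖ ≤ ‖u‖ * L := mul_le_mul_of_nonneg_left hv (norm_nonneg _)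
  nlinarith [sq_nonneg (‖u‖ - 1), norm_nonneg u, h1]

omit [DecidableEq d] in
/-- `|∫⟪u, v⟫| ≤ L (∫‖u‖² + 1)/2` for `‖v‖ ≤ L` pointwise and `u ∈ L²`. [folklore] -/
private theorem abs_integral_inner_le_half_of_norm_le {u v : UnitAddTorus d → EuclideanSpace ℝ d} (hu : MemLp u 2 volume)
    {L : ℝ} (hL : 0 ≤ L) (hvL : ∀ x, ‖v x‖ ≤ L) :
    |∫ x, ⟪u x, v x⟫_ℝ| ≤ L / 2 * (∫ x, ‖u x‖ ^ 2) + L / 2 := by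
  have iu : Integrable (fun x => ‖u x‖ ^ 2) volume := hu.integrable_norm_pow two_ne_zero
  have i1 : Integrable (fun x => L / 2 * ‖u x‖ ^ 2 + L / 2) volume := (iu.const_mul _).add (integrable_const _)
  calc |∫ x, ⟪u x, v x⟫_ℝ| ≤ ∫ x, |⟪u x, v x⟫_ℝ| := abs_integral_le_integral_abs
    _ ≤ ∫ x, (L / 2 * ‖u x‖ ^ 2 + L / 2) :=
        integral_mono_of_nonneg (ae_of_all _ fun x => abs_nonneg _) i1
          (ae_of_all _ fun x => abs_inner_le_half_of_norm_le _ _ hL (hvL x))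
    _ = L / 2 * (∫ x, ‖u x‖ ^ 2) + L / 2 := by
        rw [integral_add (iu.const_mul _) (integrable_const _), integral_const_mul, integral_const]
        simp [Measure.real]

/-- **The weak formulation of a Galerkin limit** (Robinson–Rodrigo–Sadowski 2016, Thm. 4.4 Step 4, linear terms):
for every `T > 0` and every divergence-free space–time test field `Ψ` on `[0, T)`,
`∫_{(0,T)} ∫ (⟪w, ∂ₜΨ + (b·∇)Ψ + κΔΨ⟫ + 0·⟪b, (w·∇)Ψ⟫) + ∫⟪w₀, Ψ(0)⟫ = 0`.
The Galerkin identities `PVSetup.galerkin_weak_identity` pass to the limit along the subsequence: the truncation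
inside the transport term costs `O(lattice tail)` uniformly (`norm_convect_fourierTruncate_sub_le`,
`exists_sum_norm_partialDeriv_sub_fourierTruncate_le`), the slices converge weakly in `L²`
(`IsGalerkinLimit.tendsto_integral_inner`), the tested terms are uniformly bounded, and dominated convergence in
time applies; the datum term by `tendsto_integral_inner_fourierTruncate_left_subseq`. [cite: RobinsonRodrigoSadowski2016, Thm. 4.4 Step 4] -/
theorem PVSetup.IsGalerkinLimit.weak_eq (hl : h.IsGalerkinLimit φ c w) {T : ℝ} (hT : 0 < T)
    {Ψ : ℝ → UnitAddTorus d → EuclideanSpace ℝ d} (hΨ : IsSpaceTimeTest T Ψ) (hΨdiv : ∀ t, IsDivFree (Ψ t)) :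
    (∫ t in Ioo 0 T, ∫ x, (⟪w t x, FunctionSpaces.Torus.timeDeriv Ψ t x + FunctionSpaces.Torus.convect (b t) (Ψ t) x + κ • FunctionSpaces.Torus.laplacian (Ψ t) x⟫_ℝ +
        0 * ⟪b t x, FunctionSpaces.Torus.convect (w t) (Ψ t) x⟫_ℝ)) + ∫ x, ⟪w₀ x, Ψ 0 x⟫_ℝ = 0 := by
  have hc := h.carrier
  simp only [zero_mul, add_zero]
  -- notation
  set u : ℕ → ℝ → UnitAddTorus d → EuclideanSpace ℝ d := fun n => h.galerkinApprox (φ n) with hu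
  set G : ℕ → ℝ → UnitAddTorus d → EuclideanSpace ℝ d := fun n t x =>
    FunctionSpaces.Torus.timeDeriv Ψ t x + FunctionSpaces.Torus.convect (b t) (fourierTruncate (φ n) (Ψ t)) x + κ • FunctionSpaces.Torus.laplacian (Ψ t) x with hG
  set g : ℝ → UnitAddTorus d → EuclideanSpace ℝ d := fun t x =>
    FunctionSpaces.Torus.timeDeriv Ψ t x + FunctionSpaces.Torus.convect (b t) (Ψ t) x + κ • FunctionSpaces.Torus.laplacian (Ψ t) x with hg
  set Fn : ℕ → ℝ → ℝ := fun n t => ∫ x, ⟪u n t x, G n t x⟫_ℝ with hFn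
  set Fl : ℝ → ℝ := fun t => ∫ x, ⟪w t x, g t x⟫_ℝ with hFl
  -- tails
  set τ : ℕ → ℝ := fun N => ∑' k : {k // k ∉ freqBall (d := d) N},
    ((1 + freqNormSq (k : d → ℤ)) ^ Fintype.card d)⁻¹ with hτ
  have hτ0 : Tendsto τ atTop (𝓝 0) := tendsto_tsum_compl_freqBall_inv_pow
  have hτφ : Tendsto (fun n => τ (φ n)) atTop (𝓝 0) := hτ0.comp hl.strictMono.tendsto_atTop
  have hτnn : ∀ N, 0 ≤ τ N := fun N => tsum_nonneg fun k => by
    have := freqNormSq_nonneg (k : d → ℤ)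
    positivity
  -- Step 1: the Galerkin identities, eventually (all carrier modes resolved)
  have hBev : ∀ᶠ n in atTop, B ⊆ freqBall (φ n) :=
    hl.strictMono.tendsto_atTop.eventually (tendsto_atTop.1 tendsto_freqBall_atTop B)
  have hID : ∀ᶠ n in atTop, (∫ t in Ioo 0 T, Fn n t) + ∫ x, ⟪fourierTruncate (φ n) w₀ x, Ψ 0 x⟫_ℝ = 0 :=
    hBev.mono fun n hn => h.galerkin_weak_identity hn hT hΨ hΨdiv
  -- Step 2: uniform data on `[0, T] × T^d`
  obtain ⟨Kp, KL, Kq, Cd, hCd0, hKp, hKL, -, hCd⟩ := hΨ.exists_bounds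
  obtain ⟨K₃, hK₃0, hK₃⟩ := exists_sum_norm_partialDeriv_sub_fourierTruncate_le hΨ T
  set Kb : ℝ := B.card * max C 0 with hKb
  have hKb0 : 0 ≤ Kb := by positivity
  have hbx : ∀ t x, ‖b t x‖ ≤ Kb := hc.norm_apply_le
  set E : ℝ := ∫ x, ‖w₀ x‖ ^ 2 with hE
  have hE0 : 0 ≤ E := integral_nonneg fun x => by positivity
  have huE : ∀ n t, 0 ≤ t → ∫ x, ‖u n t x‖ ^ 2 ≤ E := fun n t ht => h.integral_norm_sq_galerkinApprox_le (φ n) ht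
  have hum : ∀ n t, MemLp (u n t) 2 volume := fun n t => memLp_realTrigPoly _ _ 2
  have hKp0 : 0 ≤ Kp := (norm_nonneg _).trans (hKp 0 ⟨le_rfl, hT.le⟩ 0)
  have hKL0 : 0 ≤ KL := (norm_nonneg _).trans (hKL 0 ⟨le_rfl, hT.le⟩ 0)
  -- continuity in `x` of the tested fields
  have hGc : ∀ n t, Continuous (G n t) := fun n t =>
    ((hΨ.timeDeriv.isSmooth_slice t).continuous.add
      ((hc.isSmooth t).convect (isSmooth_fourierTruncate (φ n) (Ψ t))).continuous).add
      ((hΨ.isSmooth_slice t).laplacian.continuous.const_smul κ)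
  have hgc : ∀ t, Continuous (g t) := fun t =>
    ((hΨ.timeDeriv.isSmooth_slice t).continuous.add ((hc.isSmooth t).convect (hΨ.isSmooth_slice t)).continuous).add
      ((hΨ.isSmooth_slice t).laplacian.continuous.const_smul κ)
  -- pointwise truncation error and sup bounds of the tested fields, `t ∈ [0, T]`
  have hGg : ∀ n, ∀ t ∈ Icc 0 T, ∀ x, ‖G n t x - g t x‖ ≤ Kb * (K₃ * τ (φ n)) := by
    intro n t ht x
    have e : G n t x - g t x = FunctionSpaces.Torus.convect (b t) (fourierTruncate (φ n) (Ψ t)) x - FunctionSpaces.Torus.convect (b t) (Ψ t) x := by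
      simp only [hG, hg]; abel
    rw [e]
    exact (norm_convect_fourierTruncate_sub_le (hΨ.isSmooth_slice t) _ x).trans
      (mul_le_mul (hbx t x) (hK₃ _ t ht x) (Finset.sum_nonneg fun i _ => norm_nonneg _) hKb0)
  have hgx : ∀ t ∈ Icc 0 T, ∀ x, ‖g t x‖ ≤ Kp + Kb * Cd + |κ| * KL := by
    intro t ht x
    have h1 := hKp t ht x
    have h2 : ‖FunctionSpaces.Torus.convect (b t) (Ψ t) x‖ ≤ Kb * Cd :=
      (norm_convect_le (b t) ((hΨ.isSmooth_slice t).isContDiff (by simp)) x).trans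
        (mul_le_mul (hbx t x) (hCd t ht x) (Finset.sum_nonneg fun i _ => norm_nonneg _) hKb0)
    have h3 : ‖κ • FunctionSpaces.Torus.laplacian (Ψ t) x‖ ≤ |κ| * KL := by
      rw [norm_smul, Real.norm_eq_abs]
      exact mul_le_mul_of_nonneg_left (hKL t ht x) (abs_nonneg κ)
    calc ‖g t x‖ ≤ ‖FunctionSpaces.Torus.timeDeriv Ψ t x + FunctionSpaces.Torus.convect (b t) (Ψ t) x‖ + ‖κ • FunctionSpaces.Torus.laplacian (Ψ t) x‖ := norm_add_le _ _
      _ ≤ (‖FunctionSpaces.Torus.timeDeriv Ψ t x‖ + ‖FunctionSpaces.Torus.convect (b t) (Ψ t) x‖) + ‖κ • FunctionSpaces.Torus.laplacian (Ψ t) x‖ := by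
          gcongr; exact norm_add_le _ _
      _ ≤ Kp + Kb * Cd + |κ| * KL := by linarith
  -- Step 3: pointwise convergence of the tested terms on `[0, T]`
  have hlim : ∀ t ∈ Icc 0 T, Tendsto (fun n => Fn n t) atTop (𝓝 (Fl t)) := by
    intro t ht
    have h1 : Tendsto (fun n => ∫ x, ⟪u n t x, g t x⟫_ℝ) atTop (𝓝 (Fl t)) :=
      hl.tendsto_integral_inner ht.1 ((hgc t).memLp_of_hasCompactSupport (HasCompactSupport.of_compactSpace _))
    have h2 : Tendsto (fun n => Fn n t - ∫ x, ⟪u n t x, g t x⟫_ℝ) atTop (𝓝 0) := by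
      have hb : ∀ n, |Fn n t - ∫ x, ⟪u n t x, g t x⟫_ℝ| ≤
          Kb * (K₃ * τ (φ n)) / 2 * E + Kb * (K₃ * τ (φ n)) / 2 := by
        intro n
        have i1 : Integrable (fun x => ⟪u n t x, G n t x⟫_ℝ) volume :=
          integrable_inner_of_continuous ((hum n t).integrable one_le_two) (hGc n t)
        have i2 : Integrable (fun x => ⟪u n t x, g t x⟫_ℝ) volume :=
          integrable_inner_of_continuous ((hum n t).integrable one_le_two) (hgc t)
        have e : Fn n t - ∫ x, ⟪u n t x, g t x⟫_ℝ = ∫ x, ⟪u n t x, G n t x - g t x⟫_ℝ := by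
          simp only [hFn]
          rw [← integral_sub i1 i2]
          exact integral_congr_ae (ae_of_all _ fun x => by
            show ⟪u n t x, G n t x⟫_ℝ - ⟪u n t x, g t x⟫_ℝ = ⟪u n t x, G n t x - g t x⟫_ℝ
            rw [inner_sub_right])
        rw [e]
        have hL0 : 0 ≤ Kb * (K₃ * τ (φ n)) := mul_nonneg hKb0 (mul_nonneg hK₃0 (hτnn _))
        refine (abs_integral_inner_le_half_of_norm_le (hum n t) hL0 (hGg n t ht)).trans ?_
        have := mul_le_mul_of_nonneg_left (huE n t ht.1) (by positivity : 0 ≤ Kb * (K₃ * τ (φ n)) / 2)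
        linarith
      have h0 : Tendsto (fun n => Kb * (K₃ * τ (φ n)) / 2 * E + Kb * (K₃ * τ (φ n)) / 2) atTop (𝓝 0) := by
        have h3 : Tendsto (fun n => Kb * (K₃ * τ (φ n)) / 2) atTop (𝓝 (Kb * (K₃ * 0) / 2)) :=
          ((hτφ.const_mul K₃).const_mul Kb).div_const 2
        rw [mul_zero, mul_zero, zero_div] at h3
        have := (h3.mul_const E).add h3
        simpa using this
      exact squeeze_zero_norm (fun n => by rw [Real.norm_eq_abs]; exact hb n) h0
    have := h1.add h2
    rw [add_zero] at this
    exact this.congr fun n => by ring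
  -- Step 4: uniform bound of the tested terms, eventually
  have hτ1 : ∀ᶠ n in atTop, τ (φ n) ≤ 1 := ((tendsto_order.1 hτφ).2 1 one_pos).mono fun n hn => hn.le
  set M : ℝ := (Kp + Kb * Cd + |κ| * KL + Kb * K₃) / 2 * E + (Kp + Kb * Cd + |κ| * KL + Kb * K₃) / 2 with hM
  have hbound : ∀ᶠ n in atTop, ∀ t ∈ Icc 0 T, |Fn n t| ≤ M := by
    filter_upwards [hτ1] with n hn t ht
    have hL0 : 0 ≤ Kp + Kb * Cd + |κ| * KL + Kb * K₃ := by positivity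
    have hGx : ∀ x, ‖G n t x‖ ≤ Kp + Kb * Cd + |κ| * KL + Kb * K₃ := by
      intro x
      have h4 : Kb * (K₃ * τ (φ n)) ≤ Kb * K₃ := by
        have := mul_le_mul_of_nonneg_left hn hK₃0
        rw [mul_one] at this
        exact mul_le_mul_of_nonneg_left this hKb0
      calc ‖G n t x‖ = ‖g t x + (G n t x - g t x)‖ := by rw [add_sub_cancel]
        _ ≤ ‖g t x‖ + ‖G n t x - g t x‖ := norm_add_le _ _
        _ ≤ (Kp + Kb * Cd + |κ| * KL) + Kb * (K₃ * τ (φ n)) := add_le_add (hgx t ht x) (hGg n t ht x)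
        _ ≤ Kp + Kb * Cd + |κ| * KL + Kb * K₃ := by linarith
    refine (abs_integral_inner_le_half_of_norm_le (hum n t) hL0 hGx).trans ?_
    have := mul_le_mul_of_nonneg_left (huE n t ht.1) (by positivity : 0 ≤ (Kp + Kb * Cd + |κ| * KL + Kb * K₃) / 2)
    simp only [hM]
    linarith
  -- Step 5: dominated convergence on `(0, T)`
  have hDCT : Tendsto (fun n => ∫ t in Ioo 0 T, Fn n t) atTop (𝓝 (∫ t in Ioo 0 T, Fl t)) := by
    refine tendsto_integral_filter_of_dominated_convergence (fun _ => M) ?_ ?_ ?_ ?_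
    · exact Eventually.of_forall fun n =>
        ((h.continuousOn_galerkinTested hΨ (φ n)).mono fun t ht => (le_of_lt (ht : t ∈ Ioo 0 T).1 : t ∈ Ici 0))
          |>.aestronglyMeasurable measurableSet_Ioo
    · filter_upwards [hbound] with n hn
      rw [ae_restrict_iff' measurableSet_Ioo]
      exact ae_of_all _ fun t ht => by rw [Real.norm_eq_abs]; exact hn t (Ioo_subset_Icc_self ht)
    · exact integrableOn_const measure_Ioo_lt_top.ne
    · rw [ae_restrict_iff' measurableSet_Ioo]
      exact ae_of_all _ fun t ht => hlim t (Ioo_subset_Icc_self ht)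
  -- Step 6: the datum term and the conclusion
  have hdat := tendsto_integral_inner_fourierTruncate_left_subseq h.memLp ((hΨ.isSmooth_slice 0).memLp 2) hl.strictMono
  have hsum := hDCT.add hdat
  exact tendsto_nhds_unique_of_eventuallyEq hsum tendsto_const_nhds hID

end WeakForm

/-! ## The weak solution -/

section Solution

variable {b : ℝ → UnitAddTorus d → EuclideanSpace ℝ d} {B : Finset (d → ℤ)}
  {β : ℝ → (d → ℤ) → EuclideanSpace ℂ d} {C κ : ℝ} {Sec : Set (d → ℤ)}
  {w₀ : UnitAddTorus d → EuclideanSpace ℝ d}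
  {h : PVSetup κ b B β C Sec w₀} {φ : ℕ → ℕ} {c : ℝ → (d → ℤ) → EuclideanSpace ℂ d}
  {w : ℝ → UnitAddTorus d → EuclideanSpace ℝ d}

/-- **A Galerkin limit is a weak solution of the passive solenoidal vector equation** (`A = 0`) on `[0, T)` for
every `T > 0`, in the class `Torus.IsWeakPassiveVectorOn` (Yoshida–Kaneda 2000 (4)–(5); bookkeeping of
`PassiveVectorGalerkinExistence`, weak formulation `IsGalerkinLimit.weak_eq`). [cite: RobinsonRodrigoSadowski2016, Thm. 4.4] -/
theorem PVSetup.IsGalerkinLimit.isWeakPassiveVectorOn (hl : h.IsGalerkinLimit φ c w) {T : ℝ} (hT : 0 < T) :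
    IsWeakPassiveVectorOn 0 T κ b w₀ w where
  aestronglyMeasurable := hl.aestronglyMeasurable_Ioo T
  aestronglyMeasurable_carrier := (h.carrier.memLp_top_stLift T).1
  ae_lintegral_sq_le := ⟨_, hl.ae_lintegral_sq_le T⟩
  lintegral_carrier_lt_top := h.carrier.lintegral_carrier_lt_top T
  lintegral_mul_lt_top := hl.lintegral_mul_lt_top T
  ae_isWeaklyDivFree_carrier := ae_of_all _ fun t => h.carrier.isWeaklyDivFree t
  ae_isWeaklyDivFree := by
    filter_upwards [ae_restrict_mem measurableSet_Ioo] with t ht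
    exact hl.isWeaklyDivFree ht.1.le
  weak_eq := fun _ hΨ hΨdiv => hl.weak_eq hT hΨ hΨdiv

/-- **Existence of weak solutions by the Fourier–Galerkin method** (Robinson–Rodrigo–Sadowski 2016, Thm. 4.4, for the
passive solenoidal vector around a trigonometric-polynomial carrier): for the data `PVSetup κ b B β C Sec w₀` there is a
field `w`, a weak solution `IsWeakPassiveVectorOn 0 T κ b w₀ w` for every `T > 0`, whose slices for `t ≥ 0` lie in `L²`,
are Fourier supported in `Sec ∖ {0}`, and obey the sector-Poincaré decay `∫‖w t‖² ≤ e^{-8π²κR²t} ∫‖w₀‖²` whenever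
`R² ≤ |k|²` on `Sec ∖ {0}`. [cite: RobinsonRodrigoSadowski2016, Thm. 4.4] -/
theorem PVSetup.exists_weak_solution (h : PVSetup κ b B β C Sec w₀) :
    ∃ w : ℝ → UnitAddTorus d → EuclideanSpace ℝ d,
      (∀ T, 0 < T → IsWeakPassiveVectorOn 0 T κ b w₀ w) ∧
      (∀ t, 0 ≤ t → MemLp (w t) 2 volume) ∧
      (∀ t, 0 ≤ t → ∀ k, (k ∉ Sec ∨ k = 0) → mFourierCoeff (EuclideanSpace.complexify ∘ w t) k = 0) ∧
      ∀ R : ℝ, (∀ k, k ∈ Sec → k ≠ 0 → R ^ 2 ≤ freqNormSq k) → ∀ t, 0 ≤ t →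
        ∫ x, ‖w t x‖ ^ 2 ≤ Real.exp (-(8 * Real.pi ^ 2 * κ * R ^ 2) * t) * ∫ x, ‖w₀ x‖ ^ 2 := by
  obtain ⟨φ, c, w, hl⟩ := h.exists_isGalerkinLimit
  exact ⟨w, fun T hT => hl.isWeakPassiveVectorOn hT, hl.memLp, fun t ht k hk => hl.mFourierCoeff_eq_zero ht hk,
    fun R hR t ht => hl.integral_norm_sq_le hR ht⟩

end Solution

end Torus

end Literature.Analysis.FluidPDE
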